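import Summits.HodgeConjecture.CorCM.Census.QuaternionColumnToward
import Summits.HodgeConjecture.CorCM.Census.NondegenerateSplitting
import Summits.HodgeConjecture.CorCM.Census.NondegenerateDoubling

/-!
# The quaternion column, VII: the law `μ(Q_{2^{m+2}}, c) = φ₂` modulo the fibre-independence of the explicit family

COR-CM (cell `pub-hodgecm2`), count-neutral kernel combinatorics by the binder seat b09 (gen 39; lane QUATERNION COLUMN), part VII = the
ASSEMBLY, on parts I–VI (`Census/QuaternionColumn{Biarc,Circle,Chains,Potential,Family,Toward}.lean`), the generic covering on a set
(`Census/BaseBlockCoveringOn.lean`: `exists_joint_cover_on`, `toward_all_of_on`, `hcov_of_toward`), the META-THEOREM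
(`Census/NondegenerateSplitting.lean`: `Splitting.isLeast_card_gfaces_generate_of_residual_reduction`) and the nondegeneracy certificate of
dicyclic standard types (`Census/NondegenerateDoubling.lean`: `Nondegenerate.nondegenerate_arc_double`) used BY NAME.  Theorems only: no
definition, no `decide`, no certificate, no named fact, no `sorry`.
HONEST FRAMING: `HC_CM` is NOT proved, here or anywhere in the tree; nothing here is a period or a headline.

**THEOREM (`isLeast_card_gfaces_generate_of_indep`).**  Let `n = 2^m ≥ 4`, `G = Q_{4n} = QuaternionGroup n`, `c = a n`.  IF the explicit
family `qfam n` of part V (`5n − 9` faces: the `n` biarc faces and the two chains) is fibre-independent, THEN the least number of rank-four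
face relations whose base changes generate the integer Hodge lattice of `(G, c)` modulo pairs is EXACTLY the coinvariant fibre dimension:
**`μ(Q_{4n}, c) = φ₂(Q_{4n}, c)`**.  Everything else is proved here unconditionally and uniformly in `n`:
the standard type `T₀ = barc 0 0` is Kubota-nondegenerate (§1, part F), `G` is a `2`-group (§1), the residual types reduce onto `ℤ[G]·[T₀]`
with exponent `k = 1` (part III), the far blocks outside `blkA ∪ blkB ∪ blkC` are covered generically and jointly independently (part V +
`exists_joint_cover_on`), the explicitly covered blocks have explicit `toward` faces (part VI), so every type descends to the residual ones.
The remaining hypothesis — fibre-independence of `qfam n` — is a finite-dimensional `𝔽₂`-linear-algebra statement about an explicit family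
(numerically: parity rank `2n−3` plus the two stabiliser characters, full rank `2n−1` on the closing part, `n = 4, 8, 16`;
`HOME/pub-hodgecm2-b09/lean-g39/py2/qplan.py`); its kernel proof (parity pivots + the two biarc parity cycles detected by `θ_χ`) is the
successor's part VIII.

## References
* [Pohlmann1968] H. Pohlmann, Algebraic cycles on abelian varieties of complex multiplication type, Ann. of Math. 88 (1968), Thm 1.
-/

namespace Summit.HodgeConjecture.CorCM.Census.QuaternionColumn

open Finset QuaternionGroup
open Summit.HodgeConjecture.CorCM.Prior.AllgGroup.RfwfAllgGroup
open Summit.HodgeConjecture.CorCM.Census.BlockParity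
open Summit.HodgeConjecture.CorCM.Census.Coinvariant
open Summit.HodgeConjecture.CorCM.Census.Nondegenerate
open Summit.HodgeConjecture.CorCM.Census.Splitting
open Summit.HodgeConjecture.CorCM.Census.BaseBlock
open Summit.HodgeConjecture.CorCM.Census.TwistGeneration

noncomputable section

variable {n : ℕ} [NeZero n]

/-! ## §1 `Q_{4·2^m}` is a `2`-group; the standard type is nondegenerate -/

/-- `Q_{4n}` is a `2`-group when `n = 2^m`. [folklore] -/
theorem isPGroup_two (m : ℕ) (hn : n = 2 ^ m) : IsPGroup 2 (QuaternionGroup n) :=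
  isPGroup_two_of_card (k := m + 2) (by rw [QuaternionGroup.card, hn]; ring)

omit [NeZero n] in
/-- `n = 2^m ≥ 4` is even. [folklore] -/
theorem even_of_pow (m : ℕ) (hn : n = 2 ^ m) (h4 : 4 ≤ n) : Even n := by
  have hm : m ≠ 0 := by rintro rfl; rw [hn] at h4; norm_num at h4
  rw [hn]; exact (Nat.even_pow' hm).mpr (by norm_num)

/-- **The standard type `T₀ = barc 0 0` is the arc of `a 1` doubled by `xa 0`**: its underlying set is
`{(a 1)^i : i < n} ⊔ {xa 0 · (a 1)^i : i < n}`. [folklore] -/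
theorem base_val_eq_arc_double : (barc (0 : ZMod (2 * n)) 0).1 =
    (range n).image (fun i => (a 1 : QuaternionGroup n) ^ i) ∪ ((range n).image (fun i => (a 1 : QuaternionGroup n) ^ i)).image
      (fun g => xa 0 * g) := by
  have hn := NeZero.ne n
  ext g
  rw [mem_union, mem_image, mem_image]
  simp only [mem_image, mem_range, a_one_pow, exists_exists_and_eq_and, xa_mul_a, zero_add]
  cases g with
  | a j =>
    rw [a_mem_barc, sub_zero]
    constructor
    · intro h; exact Or.inl ⟨j.val, h, by rw [ZMod.natCast_zmod_val]⟩
    · rintro (⟨i, hi, h⟩ | ⟨i, -, h⟩)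
      · rw [← QuaternionGroup.a.inj h, val_natCast_of_lt (by omega)]; exact hi
      · cases h
  | xa j =>
    rw [xa_mem_barc, sub_zero]
    constructor
    · intro h; exact Or.inr ⟨j.val, h, by rw [ZMod.natCast_zmod_val]⟩
    · rintro (⟨i, -, h⟩ | ⟨i, hi, h⟩)
      · cases h
      · rw [← QuaternionGroup.xa.inj h, val_natCast_of_lt (by omega)]; exact hi

/-- **`T₀ = barc 0 0` is Kubota-nondegenerate** (part F: the arc of `u = a 1` of order `2n` with `u^n = c`, doubled by `x = xa 0`, `x² = c`).
[folklore] -/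
theorem nondegenerate_base : ∀ f : QuaternionGroup n → ℤ, (∀ Q, f (c n * Q) = -f Q) →
    (∀ y, ∑ Q, f Q * indG (barc (0 : ZMod (2 * n)) 0).1 (y * Q) = 0) → ∀ Q, f Q = 0 := by
  have hn := NeZero.ne n
  refine nondegenerate_arc_double (c n) c_mul_c c_comm (a 1) (xa 0) n (Nat.one_le_iff_ne_zero.mpr hn) orderOf_a_one
    (by rw [a_one_pow]; rfl) (xa_mul_xa_self 0) ?_ (barc 0 0) base_val_eq_arc_double
  rw [disjoint_left]
  rintro g hg hg'
  obtain ⟨i, -, rfl⟩ := mem_image.mp hg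
  obtain ⟨g', hg'', h⟩ := mem_image.mp hg'
  obtain ⟨j, -, rfl⟩ := mem_image.mp hg''
  rw [a_one_pow, a_one_pow, xa_mul_a] at h
  cases h

/-! ## §2 The law modulo fibre-independence of the explicit family -/

/-- **THE QUATERNION LAW MODULO INDEPENDENCE**: for `n = 2^m ≥ 4`, if the explicit family `qfam n` is fibre-independent then
`μ(Q_{4n}, c) = φ₂(Q_{4n}, c)`. [folklore] -/
theorem isLeast_card_gfaces_generate_of_indep (m : ℕ) (hn : n = 2 ^ m) (h4 : 4 ≤ n)
    (hli : LinearIndepOn (ZMod 2) (fun f : CMF (QuaternionGroup n) (c n) →₀ ℤ => (rad2 (c n) c_mul_c).mkQ (red (c n) f)) ↑(qfam n)) :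
    IsLeast {k : ℕ | ∃ S : Finset (CMF (QuaternionGroup n) (c n) →₀ ℤ), (↑S ⊆ gfaceSet (QuaternionGroup n) (c n) c_mul_c) ∧ S.card = k ∧
      hodgeSpan (c n) c_mul_c ≤ Submodule.span ℤ (pairSet (c n)) ⊔ Submodule.span ℤ (translates (c n) S)} (fibreTwo (c n) c_mul_c) := by
  classical
  have heven := even_of_pow m hn h4
  -- the far set: blocks of potential `≥ 2` not covered explicitly
  set far : Block (c n) → Prop := fun B => 2 ≤ bpot (c n) (barc 0 0) B.out ∧ B ∉ blkA n ∪ blkB n ∪ blkC n with hfar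
  obtain ⟨S₂, hS₂, -, -, hliU, -, htow⟩ := exists_joint_cover_on (c n) (barc 0 0) c_mul_c far (fun B hB => hB.1) (qfam n) hli
    (fun f hf B hB => par_qfam_eq_zero_of_far h4 hf B hB)
  set S := qfam n ∪ S₂ with hSdef
  have hqS : qfam n ⊆ S := subset_union_left
  have hSsub : (↑S : Set (CMF (QuaternionGroup n) (c n) →₀ ℤ)) ⊆ gfaceSet (QuaternionGroup n) (c n) c_mul_c := by
    rw [hSdef, coe_union]; exact Set.union_subset (qfam_subset_gfaceSet (by omega)) hS₂
  -- the `toward` property through every type of potential `≥ 2`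
  have hL : ∀ Φ : CMF (QuaternionGroup n) (c n), 2 ≤ bpot (c n) (barc 0 0) Φ →
      ∃ Q t t' : QuaternionGroup n, bpot (c n) (barc 0 0) Φ = ddist (rt (c n) Q (barc 0 0)) Φ ∧
        t ∈ (rt (c n) Q (barc 0 0)).1 \ Φ.1 ∧ t' ∈ (rt (c n) Q (barc 0 0)).1 \ Φ.1 ∧ t ≠ t' ∧
          gface (c n) c_mul_c Φ t t' ∈ Submodule.span ℤ (pairSet (c n)) ⊔ Submodule.span ℤ (translates (c n) S) := by
    refine toward_all_of_on (c n) (barc 0 0) c_mul_c far _ (fun Φ hΦ => htow _ ?_ Φ hΦ) (fun Φ hΦ hnot => ?_)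
    · refine (Submodule.span_mono ?_).trans le_sup_right
      rintro _ ⟨Q, s, hs, rfl⟩
      exact ⟨Q, s, mem_union_right _ hs, rfl⟩
    · have hX : blk (c n) Φ ∈ blkA n ∪ blkB n ∪ blkC n := by
        by_contra h
        exact hnot ⟨by rw [bpot_out]; exact hΦ, h⟩
      exact toward_off heven h4 S hqS Φ hX
  refine isLeast_card_gfaces_generate_of_residual_reduction (c n) (isPGroup_two m hn) c_mul_c c_ne_one c_comm (barc 0 0)
    nondegenerate_base S hSsub hliU (hcov_of_toward (c n) (barc 0 0) c_mul_c S hL) 1 ?_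
  exact residual_reduction_quaternion S (fun k hk => hqS (fplus_mem_qfam k hk)) (fun i h1 h2 => hqS (f_mem_qfam i h1 h2))
    (fun i h1 h2 => hqS (c_mem_qfam i h1 h2)) (fun j h1 h2 => hqS (f'_mem_qfam j h1 h2)) (fun j h1 h3 => hqS (c'_mem_qfam j h1 h3))

end

end Summit.HodgeConjecture.CorCM.Census.QuaternionColumn
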